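import Literature.NumberTheory.GaloisRepresentations.TameInertiaKummerProofs
import Literature.NumberTheory.GaloisRepresentations.SerreWeightExistenceProofs
import Literature.NumberTheory.GaloisRepresentations.ArtinConductorHerbrandProofs
import HarnessLib

/-!
# Serre's weight recipe applies: `isSerreWeight_serreWeightLocal` in every characteristic (trunk GalRep, item C16)

D-0014 keeps `Literature/` sorry-free by stating cited results as named facts `def X : Prop`.
This file discharges the named fact `Literature.NumberTheory.GaloisRepresentations.ModPGaloisRep.isSerreWeight_serreWeightLocal` of
`Literature.NumberTheory.GaloisRepresentations.SerreWeight`: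

* `Literature.ModPGaloisRep.isSerreWeight_serreWeightLocal_holds : ρ.isSerreWeight_serreWeightLocal ι` —
  for every non-archimedean local field `F` (any characteristic), every continuous
  `ρ̄ : Γ_F → GL₂(k)` with `k` discrete and every residue embedding `ι : S ⧸ 𝔓 →+* k`, the weight
  `serreWeightLocal ρ ι` satisfies Serre's recipe: one of the three cases — level two
  (`IsLevelTwoWeight`, §2.2), level one tame (`IsLevelOneTameWeight`, §2.3), level one wild
  (`IsLevelOneWildWeight`, §2.4) — applies, with Serre's normalisations of the exponents.

It is an application of landed theorems: the in-file reduction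
`isSerreWeight_serreWeightLocal_of` (by `Nat.sInf_mem` in each case) to the existence statement
`exists_isSerreWeight ρ ι` (Serre, Duke Math. J. 54 (1987), §2.1 Prop. 1 with §2.2–2.4); its
assembly `ModPGaloisRep.exists_isSerreWeight_holds_of_herbrand_quotient`
(`SerreWeightExistenceProofs.lean`, valid in every characteristic) from Herbrand's theorem at the
finite layers of `F̄` and the structure of the characters of `I_F`; and the discharges of these
two leaves, `herbrand_quotient_holds` (`ArtinConductorHerbrandProofs.lean`, from the index formula
of `HerbrandQuotientFormula.lean`; Serre, *Local Fields*, Ch. IV §3 Prop. 14) and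
`exists_eq_kummerCharacter_pow_holds` (`TameInertiaKummerProofs.lean`; Serre, Invent. Math. 15
(1972), §1.7 Prop. 5).  The characteristic-`0` case and the global form
`isSerreWeight_serreWeight_holds` are in `SerreWeightBoundsProofs.lean`.

## References

* [Serre1987] J.-P. Serre, *Sur les représentations modulaires de degré 2 de `Gal(ℚ̄/ℚ)`*, Duke
  Math. J. 54 (1987) (= Œuvres IV, no. 143, pp. 125–128), §2.1 Prop. 1; §2.2 (2.2.1)–(2.2.4);
  §2.3 (2.3.1)–(2.3.2); §2.4 (2.4.1)–(2.4.9).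
* [SerreLocalFields1979] J.-P. Serre, *Local Fields*, GTM 67 (1979), Ch. IV §2–§3.
* [SerreInventiones1972] J.-P. Serre, Invent. Math. 15 (1972), §1.3, §1.7.
-/

noncomputable section

open scoped Valued
open Field ValuativeRel

namespace Literature.NumberTheory.GaloisRepresentations

namespace ModPGaloisRep

open GaloisRepresentations.IsNonarchimedeanLocalField

universe u v

variable {F : Type u} [Field F] [ValuativeRel F] [TopologicalSpace F] [IsNonarchimedeanLocalField F]
variable {k : Type v} [Field k] [TopologicalSpace k]

/-- **Discharge of `isSerreWeight_serreWeightLocal`**: the weight `serreWeightLocal ρ ι`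
satisfies Serre's recipe, for every `ρ̄ : Γ_F → GL₂(k)` (`k` discrete) and every residue
embedding `ι`: `isSerreWeight_serreWeightLocal_of` applied to the existence of a Serre weight,
`exists_isSerreWeight_holds_of_herbrand_quotient` fed with `herbrand_quotient_holds` and
`exists_eq_kummerCharacter_pow_holds`.
Ref: Serre, Duke Math. J. 54 (1987), §2.1 Prop. 1 (structure of `ρ_p|I`), §2.2–2.4 (the three
cases of the recipe). [cite: Serre1987, §2.1 Prop. 1; §2.2–2.4] -/
theorem isSerreWeight_serreWeightLocal_holds (ρ : ModPGaloisRep F k 2)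
    (ι : absIntegers 𝒪[F] F ⧸ absMaximalIdeal F →+* k) :
    ρ.isSerreWeight_serreWeightLocal ι :=
  ρ.isSerreWeight_serreWeightLocal_of ι
    (exists_isSerreWeight_holds_of_herbrand_quotient
      (fun hle => herbrand_quotient_holds 𝒪[F] (IntermediateField.restrict hle))
      (exists_eq_kummerCharacter_pow_holds F k) ρ ι)

end ModPGaloisRep

end Literature.NumberTheory.GaloisRepresentations
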